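import Mathlib
import Literature.AlgebraicGeometry.Resolution.FrobeniusPowerTranslateOrder
import HarnessLib

/-!
# The conormal map `𝔪/𝔪² → κ ⊗ Ω[O⁄R]` is split injective when the residue field is formally smooth

Topic: `Literature/AlgebraicGeometry/Resolution` (sibling of `FrobeniusPowerTranslateOrder.lean`, the easy half
«`f ∈ 𝔪² ⇒ 1 ⊗ df = 0`»). The second fundamental exact sequence of a surjection `P → S = P/I` of `R`-algebras,
`I/I² —δ→ S ⊗_P Ω[P⁄R] → Ω[S⁄R] → 0`, `δ(x mod I²) = dx ⊗ 1`, is SPLIT EXACT on the left as soon as `S` is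
`0`-smooth (formally smooth) over `R` ([Matsumura1987] Thm. 25.2, second part; [StacksProject] Tag 031I): the
square-zero extension `P/I² → S` then has an `R`-algebra section, and sections correspond to retractions of `δ`
(Mathlib's `retractionKerCotangentToTensorEquivSection`). Mathlib states the resulting criterion
(`Algebra.FormallySmooth.iff_split_injection`) only under the standing hypothesis «`P` formally smooth over `R`»;
the direction recorded here needs NO hypothesis on `P`.

Applied to a local ring `(O, 𝔪, κ)` that is an `R`-algebra with `κ` FORMALLY SMOOTH over `R` — e.g. `R = K` a
field and `κ/K` separable algebraic (Mathlib `Algebra.FormallyEtale.of_isSeparable`), in particular `K` perfect and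
`κ/K` algebraic (closed points of schemes locally of finite type over a perfect field) — this gives the converse of
`FrobeniusPowerTranslateOrder`'s «`1 ⊗ df ≠ 0 ⇒ f ∉ 𝔪²`»: **for `f ∈ 𝔪`, `1 ⊗ df = 0` in `κ ⊗_O Ω[O⁄R]` iff
`f ∈ 𝔪²`, i.e. `ord_𝔪(f) = 1` iff the differential of `f` does not vanish at the closed point.** So for a function
`y` vanishing at a closed point `η` (residue field separable over the base) the two formulations «`dy(η) ≠ 0`» and
«`ord_η(y) = 1`» of "regular parameter" coincide. No regularity or Noetherian hypothesis on `O`.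

## Contents (namespace `Literature.AlgebraicGeometry.Resolution`)
* `exists_section_kerSquareLift_of_formallySmooth` — `S` formally smooth over `R`, `P → S` surjective ⇒ the
  square-zero extension `P/I² → S` has an `R`-algebra section.
* `exists_retraction_kerCotangentToTensor_of_formallySmooth`, `kerCotangentToTensor_injective_of_formallySmooth` —
  hence `δ : I/I² → S ⊗_P Ω[P⁄R]` has a `P`-linear retraction and is injective.
* `mem_sq_maximalIdeal_of_one_tmul_D_eq_zero`, `one_tmul_D_eq_zero_iff_mem_sq`,
  `adicOrder_eq_one_iff_one_tmul_D_ne_zero` — local ring with formally smooth residue field.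
* `adicOrder_eq_one_iff_one_tmul_D_ne_zero_of_isSeparable` — base a field `K`, `κ/K` separable.

## Sources
* H. Matsumura, *Commutative Ring Theory* (1986), Thm. 25.2 (second fundamental exact sequence; split exact when
  `B` is `0`-smooth over `k`). [Matsumura1987]
* The Stacks Project, Tag 031I. [StacksProject]
-/

open scoped TensorProduct
open IsLocalRing KaehlerDifferential

namespace Literature.AlgebraicGeometry.Resolution

universe u v w

/-! ## Surjections onto a formally smooth algebra: the square-zero extension splits -/

section General

variable {R : Type u} {P : Type v} {S : Type w} [CommRing R] [CommRing P] [CommRing S]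
  [Algebra R P] [Algebra P S] [Algebra R S] [IsScalarTower R P S]

/-- If `S` is formally smooth over `R` and `P → S` is a surjection of `R`-algebras with kernel `I`, then the
square-zero extension `P/I² → S` has an `R`-algebra section (infinitesimal lifting against the square-zero ideal
`I/I²`). No hypothesis on `P`. [cite: Matsumura1987, Thm. 25.2 (second part: split exact when B is 0-smooth)]
[cite: StacksProject, Tag 031I] -/
theorem exists_section_kerSquareLift_of_formallySmooth [Algebra.FormallySmooth R S]
    (hf : Function.Surjective (algebraMap P S)) :
    ∃ g : S →ₐ[R] P ⧸ RingHom.ker (algebraMap P S) ^ 2,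
      (IsScalarTower.toAlgHom R P S).kerSquareLift.comp g = AlgHom.id R S := by
  set F : (P ⧸ RingHom.ker (IsScalarTower.toAlgHom R P S).toRingHom ^ 2) →ₐ[R] S :=
    (IsScalarTower.toAlgHom R P S).kerSquareLift with hF
  have surj : Function.Surjective F := Ideal.Quotient.lift_surjective_of_surjective _ _ hf
  have sqz : RingHom.ker F.toRingHom ^ 2 = ⊥ := by
    rw [hF, AlgHom.ker_kerSquareLift, Ideal.cotangentIdeal_square]
  have nil : IsNilpotent (RingHom.ker (F : (P ⧸ RingHom.ker (IsScalarTower.toAlgHom R P S).toRingHom ^ 2) →+* S)) :=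
    ⟨2, by rw [← AlgHom.toRingHom_eq_coe, sqz, Ideal.zero_eq_bot]⟩
  exact ⟨Algebra.FormallySmooth.liftOfSurjective (AlgHom.id R S) F surj nil,
    Algebra.FormallySmooth.comp_liftOfSurjective _ _ surj nil⟩

/-- **Second fundamental exact sequence, split part**: if `S` is formally smooth over `R` and `P → S` is a surjection
of `R`-algebras with kernel `I`, the conormal map `δ : I/I² → S ⊗_P Ω[P⁄R]`, `x ↦ 1 ⊗ dx`
(`KaehlerDifferential.kerCotangentToTensor`) has a `P`-linear retraction. No hypothesis on `P`.
[cite: Matsumura1987, Thm. 25.2 (second part)] [cite: StacksProject, Tag 031I] -/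
theorem exists_retraction_kerCotangentToTensor_of_formallySmooth [Algebra.FormallySmooth R S]
    (hf : Function.Surjective (algebraMap P S)) :
    ∃ l : S ⊗[P] Ω[P⁄R] →ₗ[P] (RingHom.ker (algebraMap P S)).Cotangent,
      l ∘ₗ kerCotangentToTensor R P S = LinearMap.id := by
  obtain ⟨g, hg⟩ := exists_section_kerSquareLift_of_formallySmooth (R := R) (P := P) (S := S) hf
  obtain ⟨l, hl⟩ := (retractionKerCotangentToTensorEquivSection (R := R) (P := P) (S := S) hf).symm ⟨g, hg⟩
  exact ⟨l, hl⟩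

/-- Hence the conormal map `δ : I/I² → S ⊗_P Ω[P⁄R]` is injective when `S` is formally smooth over `R`.
[cite: Matsumura1987, Thm. 25.2 (second part)] [cite: StacksProject, Tag 031I] -/
theorem kerCotangentToTensor_injective_of_formallySmooth [Algebra.FormallySmooth R S]
    (hf : Function.Surjective (algebraMap P S)) : Function.Injective (kerCotangentToTensor R P S) := by
  obtain ⟨l, hl⟩ := exists_retraction_kerCotangentToTensor_of_formallySmooth (R := R) (P := P) (S := S) hf
  exact Function.LeftInverse.injective (g := l) fun x => LinearMap.congr_fun hl x

end General

/-! ## Local rings with formally smooth residue field -/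

section Local

variable {R : Type u} {O : Type v} [CommRing R] [CommRing O] [IsLocalRing O] [Algebra R O]

/-- In a local ring `(O, 𝔪, κ)` over `R` whose residue field `κ` is formally smooth over `R`: if `f ∈ 𝔪` and the
differential of `f` vanishes at the closed point (`1 ⊗ df = 0` in `κ ⊗_O Ω[O⁄R]`), then `f ∈ 𝔪²` (injectivity of
`𝔪/𝔪² → κ ⊗_O Ω[O⁄R]`). [cite: Matsumura1987, Thm. 25.2 (second part)] -/
theorem mem_sq_maximalIdeal_of_one_tmul_D_eq_zero [Algebra.FormallySmooth R (ResidueField O)] {f : O}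
    (hf : f ∈ maximalIdeal O) (h : (1 : ResidueField O) ⊗ₜ[O] (D R O f) = 0) :
    f ∈ maximalIdeal O ^ 2 := by
  have hsurj : Function.Surjective (algebraMap O (ResidueField O)) := by
    rw [ResidueField.algebraMap_eq]; exact residue_surjective
  have hker : RingHom.ker (algebraMap O (ResidueField O)) = maximalIdeal O := by
    rw [ResidueField.algebraMap_eq]; exact ker_residue
  have hfJ : f ∈ RingHom.ker (algebraMap O (ResidueField O)) := by rw [hker]; exact hf
  have hinj := kerCotangentToTensor_injective_of_formallySmooth (R := R) (P := O) (S := ResidueField O) hsurj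
  have h0 : kerCotangentToTensor R O (ResidueField O) ((RingHom.ker _).toCotangent ⟨f, hfJ⟩) = 0 := by
    rw [kerCotangentToTensor_toCotangent]; exact h
  have h1 : (RingHom.ker (algebraMap O (ResidueField O))).toCotangent ⟨f, hfJ⟩ = 0 :=
    hinj (by rw [h0, map_zero])
  have h2 : f ∈ RingHom.ker (algebraMap O (ResidueField O)) ^ 2 := (Ideal.toCotangent_eq_zero _ _).mp h1
  rwa [hker] at h2

/-- In a local ring over `R` with formally smooth residue field, for `f ∈ 𝔪`: `1 ⊗ df = 0` in `κ ⊗_O Ω[O⁄R]` iff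
`f ∈ 𝔪²` (exactness of `0 → 𝔪/𝔪² → κ ⊗ Ω[O⁄R]`). [cite: Matsumura1987, Thm. 25.2] -/
theorem one_tmul_D_eq_zero_iff_mem_sq [Algebra.FormallySmooth R (ResidueField O)] {f : O}
    (hf : f ∈ maximalIdeal O) :
    (1 : ResidueField O) ⊗ₜ[O] (D R O f) = 0 ↔ f ∈ maximalIdeal O ^ 2 :=
  ⟨mem_sq_maximalIdeal_of_one_tmul_D_eq_zero (R := R) hf, one_tmul_D_eq_zero_of_mem_sq (R := R)⟩

/-- **`ord_𝔪(f) = 1` iff `df` does not vanish at the closed point**, for `f ∈ 𝔪` in a local ring over `R` whose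
residue field is formally smooth over `R` (any `O`: no Noetherian or regularity hypothesis).
[cite: Matsumura1987, Thm. 25.2] -/
theorem adicOrder_eq_one_iff_one_tmul_D_ne_zero [Algebra.FormallySmooth R (ResidueField O)] {f : O}
    (hf : f ∈ maximalIdeal O) :
    adicOrder f = 1 ↔ (1 : ResidueField O) ⊗ₜ[O] (D R O f) ≠ 0 := by
  constructor
  · intro h1 h0
    have h2 : ((2 : ℕ) : ℕ∞) ≤ adicOrder f :=
      (le_adicOrder_iff f 2).mpr (mem_sq_maximalIdeal_of_one_tmul_D_eq_zero (R := R) hf h0)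
    rw [h1] at h2
    exact absurd h2 (by decide)
  · exact adicOrder_eq_one_of_mem_of_one_tmul_D_ne_zero (R := R) hf

/-- **Base a field with separable residue field.** For a local algebra `(O, 𝔪, κ)` over a field `K` with `κ/K`
separable (automatic when `K` is perfect and `κ/K` is algebraic, e.g. the local ring of a closed point of a scheme
locally of finite type over a perfect field) and `f ∈ 𝔪`: `ord_𝔪(f) = 1` iff `1 ⊗ df ≠ 0` in `κ ⊗_O Ω[O⁄K]`
(`κ` is formally étale, hence formally smooth, over `K`: Mathlib `Algebra.FormallyEtale.of_isSeparable`).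
[cite: Matsumura1987, Thm. 25.2, with Thm. 26.9 (separable ⇒ 0-smooth)] -/
theorem adicOrder_eq_one_iff_one_tmul_D_ne_zero_of_isSeparable {K : Type u} [Field K] [Algebra K O]
    [Algebra.IsSeparable K (ResidueField O)] {f : O} (hf : f ∈ maximalIdeal O) :
    adicOrder f = 1 ↔ (1 : ResidueField O) ⊗ₜ[O] (D K O f) ≠ 0 := by
  haveI : Algebra.FormallyEtale K (ResidueField O) := Algebra.FormallyEtale.of_isSeparable K (ResidueField O)
  exact adicOrder_eq_one_iff_one_tmul_D_ne_zero (R := K) hf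

end Local

end Literature.AlgebraicGeometry.Resolution
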